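import Mathlib.Analysis.SpecialFunctions.Pow.Real

/-!
# `Balaban1983to89.B9Eq3126QG1QClosingBetaWindow` — T. Bałaban, *Propagators for lattice gauge theories in a background field*, Commun. Math. Phys. **99** (1985)
# 389–434 [Balaban1985BackgroundPropagators] (3.126) p. 420, (3.49) p. 399, Thm 3.11 p. 416 with [Balaban1985Variational] (45) p. 285: **THE SECOND CLOSING
# CONDITION OF ROAD ΔA-CT — `B9Eq3126ConjugatedQG1QLetters`' window `small2 : s₁ ≤ μ₁∕2` for the conjugated inverse Gram operator `(QG₁Q*)⁻¹` — SOLVED FOR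
# THE CONJUGATION PARAMETER `β`: ONE MORE LINEAR β-CONSTRAINT `β·N₁ ≤ μ₁∕2 − β_K·C_Q(C_Q+1)(4∕γ)²`** (the located remark L-g142-4 of the NE9 crux-ideation seat
# t4-ne9-idea-1 gen 142, journal 2026-08-24T18:18:33Z, made a lemma; companion of `B9Eq326ClosingBetaWindow` = their kernel D for the first window `small`):
# with the adopted suppliers `C_P ≤ P` (e.g. `P = √(C_Q∕√κ₁)`, `B9Eq325ProjectionDivergenceQuarterKappa`) and `ρ ≤ 15·(β·s_A)∕√κ₁`
# (`B9Eq349ConjugatedProjectionDifferenceChain`), `s₁ = β(4∕γ)(2C_Q + 1) + C_Q(C_Q + 1)·(β·c_β(C_P) + ρ·c_ρ(C_P) + β_K(4∕γ)²)` is AFFINE in the two history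
# letters: `s₁ ≤ β·N₁ + β_K·C_Q(C_Q + 1)(4∕γ)²`, `N₁ = (4∕γ)(2C_Q + 1) + C_Q(C_Q + 1)·(c_β(P) + 15·s_A·c_ρ(P)∕√κ₁)` height-free — so `small2` follows from ONE
# linear constraint, the window `β ≤ β₁ := (μ₁∕2 − β_K·C_Q(C_Q+1)(4∕γ)²)∕N₁` is NON-EMPTY iff `β_K·C_Q(C_Q + 1)(4∕γ)² < μ₁∕2`, and together with
# `B9Eq326ClosingBetaWindow.closing_of_beta_le_beta0` ONE `β ≤ min β₀ β₁` closes every side condition of the `G₁` ∕ `(QG₁Q*)⁻¹` decay files of the road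

statement-level skeleton of published theorems with citation tags; proofs where landed; nothing here is a claim about the Yang–Mills mass gap

CITATION HEADER (lean-in-tree rule).  Audit cell `pub-balaban`, sub-cell `t4`, BINDER row NE9 (road ΔA-CT, NE9 formalisation-swarm leaf prover 03
`b2b-balaban-t4-ne9-formalise-leaf-03` gen 75; the constraint's shape is t4-ne9-idea-1 g142's located remark L-g142-4 — CREDIT).  Mathlib only.  Sources READ
first-hand: [Balaban1985BackgroundPropagators] p. 420 (3.126), p. 399 (3.49), p. 416 Thm 3.11; [Balaban1985Variational] p. 285 (45).  Pure real arithmetic on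
the road's displayed letters; nothing of print's is asserted; no number of record.

WHAT IS PROVED (sorry-free; proof lane — no `def`; [folklore] real arithmetic).
* `cbeta_mono`, `crho_nonneg`, `crho_mono` — the two resolvent-comparison constants of `B9Eq326ConjugatedDeltaAResolvent.norm_Gk_sub_G_le` are monotone in `C_P`;
* **`s1_le_affine`** — `s₁ ≤ β·N₁ + β_K·C_Q(C_Q+1)(4∕γ)²` from `C_P ≤ P`, `0 ≤ ρ ≤ 15(βs_A)∕√κ₁`;
* **`small2_of_beta_linear`** — `β·N₁ ≤ μ₁∕2 − β_K·C_Q(C_Q+1)(4∕γ)² ⟹ small2` (the window of `B9Eq3126ConjugatedQG1QLetters.norm_c1k_le` ∕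
  `B9Eq3126ConjugatedQG1QInv.norm_conjKinv_le` ∕ `B9Eq3126QG1QInvPointDecay.norm_bondPoint_Kinv_le` VERBATIM);
* `N1_pos`, **`beta1_pos`** (`β_K·C_Q(C_Q+1)(4∕γ)² < μ₁∕2 ⟹ 0 < β₁`), **`small2_of_beta_le_beta1`**.
HONEST SCOPE.  Abstract; `γ, a, β_K, C_Q, κ₁, s_A, μ₁, P` displayed; no number; NOT NE9 (cell pub-balaban: NE9 NOT PRINTED ∕ NOT PROVED; «NE9 ⇐ the named
binders»; row WALLED ON A MODEL (O-NE9-1; #5 UNRULED); spine PROVED 0∕9; rung (B)+1 on a finite T⁴ — NOT infinite volume, NOT mass gap, NOT BetaPertH, NOT Clay;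
HONEST DEPENDENCY: continuum YM on T⁴ ⇐ BetaPertH ∧ nine spine estimates (0/9 proved); BetaPertH ⇐ (D1) ∧ (D4) ∧ CAP+tail).  NEW file; nothing modified.
Net new unproved facts: 0.
-/

namespace Literature.MathematicalPhysics.QuantumFieldTheory.Balaban1983to89.B9Eq3126QG1QClosingBetaWindow

/-- **`c_β` IS MONOTONE IN `C_P`**: the `β`-coefficient of the resolvent comparison,
`c_β(C_P) = (4∕γ)(2(8∕γ) + (8∕γ + 4∕γ) + 2((8∕γ + (4∕γ)C_P) + 4∕γ) + aC_Q(4∕γ) + a(C_Q+1)(4∕γ))`. [folklore] [cite: Balaban1985BackgroundPropagators, (3.49) p.399] -/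
theorem cbeta_mono {γ a CQ CP P : ℝ} (hγ : 0 < γ) (hCPP : CP ≤ P) :
    4 / γ * (2 * (8 / γ) + (8 / γ + 4 / γ) + 2 * ((8 / γ + 4 / γ * CP) + 4 / γ) + a * CQ * (4 / γ) + a * (CQ + 1) * (4 / γ)) ≤
      4 / γ * (2 * (8 / γ) + (8 / γ + 4 / γ) + 2 * ((8 / γ + 4 / γ * P) + 4 / γ) + a * CQ * (4 / γ) + a * (CQ + 1) * (4 / γ)) := by
  have hg : 0 ≤ 4 / γ := by positivity
  refine mul_le_mul_of_nonneg_left ?_ hg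
  have := mul_le_mul_of_nonneg_left hCPP hg
  linarith

/-- `0 ≤ c_ρ(C_P) = (8∕γ + (4∕γ)C_P)((8∕γ + (4∕γ)C_P) + 4∕γ)` for `C_P ≥ 0`. [folklore] [cite: Balaban1985BackgroundPropagators, (3.49) p.399] -/
theorem crho_nonneg {γ CP : ℝ} (hγ : 0 < γ) (hCP : 0 ≤ CP) : 0 ≤ (8 / γ + 4 / γ * CP) * ((8 / γ + 4 / γ * CP) + 4 / γ) := by positivity

/-- **`c_ρ` IS MONOTONE IN `C_P`** (on `C_P ≥ 0`). [folklore] [cite: Balaban1985BackgroundPropagators, (3.49) p.399] -/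
theorem crho_mono {γ CP P : ℝ} (hγ : 0 < γ) (hCP : 0 ≤ CP) (hCPP : CP ≤ P) :
    (8 / γ + 4 / γ * CP) * ((8 / γ + 4 / γ * CP) + 4 / γ) ≤ (8 / γ + 4 / γ * P) * ((8 / γ + 4 / γ * P) + 4 / γ) := by
  have hg : 0 ≤ 4 / γ := by positivity
  have h1 : 8 / γ + 4 / γ * CP ≤ 8 / γ + 4 / γ * P := by have := mul_le_mul_of_nonneg_left hCPP hg; linarith
  have h0 : 0 ≤ 8 / γ + 4 / γ * CP := by positivity
  exact mul_le_mul h1 (by linarith) (by positivity) (h0.trans h1)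

/-- **`s₁` IS AFFINE IN THE HISTORY LETTERS AT THE ROAD'S CLOSING**: with `C_P ≤ P`, `0 ≤ ρ ≤ 15(βs_A)∕√κ₁` and signs,
`s₁ ≤ β·N₁ + β_K·C_Q(C_Q+1)(4∕γ)²`, `N₁ = (4∕γ)(2C_Q+1) + C_Q(C_Q+1)(c_β(P) + 15·s_A·c_ρ(P)∕√κ₁)`.
[folklore] (t4-ne9-idea-1 g142, L-g142-4) [cite: Balaban1985BackgroundPropagators, (3.126) p.420, (3.49) p.399] -/
theorem s1_le_affine {γ a βK CQ κ₁ sA β CP P ρ : ℝ} (hγ : 0 < γ) (hCQ : 0 ≤ CQ) (hκ₁ : 0 < κ₁) (hβ : 0 ≤ β)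
    (hCP : 0 ≤ CP) (hCPP : CP ≤ P) (hρ : 0 ≤ ρ) (hρle : ρ ≤ 15 * (β * sA) / Real.sqrt κ₁) :
    β * (4 / γ) * (2 * CQ + 1) + CQ * (CQ + 1) *
        (β * (4 / γ * (2 * (8 / γ) + (8 / γ + 4 / γ) + 2 * ((8 / γ + 4 / γ * CP) + 4 / γ) + a * CQ * (4 / γ) + a * (CQ + 1) * (4 / γ))) +
          ρ * ((8 / γ + 4 / γ * CP) * ((8 / γ + 4 / γ * CP) + 4 / γ)) + βK * (4 / γ) ^ 2) ≤
      β * (4 / γ * (2 * CQ + 1) + CQ * (CQ + 1) *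
          (4 / γ * (2 * (8 / γ) + (8 / γ + 4 / γ) + 2 * ((8 / γ + 4 / γ * P) + 4 / γ) + a * CQ * (4 / γ) + a * (CQ + 1) * (4 / γ)) +
            15 * sA * ((8 / γ + 4 / γ * P) * ((8 / γ + 4 / γ * P) + 4 / γ)) / Real.sqrt κ₁)) +
        βK * (CQ * (CQ + 1) * (4 / γ) ^ 2) := by
  have hsq : 0 < Real.sqrt κ₁ := Real.sqrt_pos.mpr hκ₁
  have hcb := cbeta_mono (a := a) (CQ := CQ) hγ hCPP
  have hcr := crho_mono hγ hCP hCPP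
  have hcr0 := crho_nonneg hγ hCP
  have hcrP : 0 ≤ (8 / γ + 4 / γ * P) * ((8 / γ + 4 / γ * P) + 4 / γ) := hcr0.trans hcr
  -- `β·c_β(C_P) ≤ β·c_β(P)`
  have t1 : β * (4 / γ * (2 * (8 / γ) + (8 / γ + 4 / γ) + 2 * ((8 / γ + 4 / γ * CP) + 4 / γ) + a * CQ * (4 / γ) + a * (CQ + 1) * (4 / γ))) ≤
      β * (4 / γ * (2 * (8 / γ) + (8 / γ + 4 / γ) + 2 * ((8 / γ + 4 / γ * P) + 4 / γ) + a * CQ * (4 / γ) + a * (CQ + 1) * (4 / γ))) :=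
    mul_le_mul_of_nonneg_left hcb hβ
  -- `ρ·c_ρ(C_P) ≤ (15βs_A∕√κ₁)·c_ρ(P)`
  have t2 : ρ * ((8 / γ + 4 / γ * CP) * ((8 / γ + 4 / γ * CP) + 4 / γ)) ≤
      15 * (β * sA) / Real.sqrt κ₁ * ((8 / γ + 4 / γ * P) * ((8 / γ + 4 / γ * P) + 4 / γ)) :=
    (mul_le_mul_of_nonneg_left hcr hρ).trans (mul_le_mul_of_nonneg_right hρle hcrP)
  have hC2 : 0 ≤ CQ * (CQ + 1) := by positivity
  have t3 := mul_le_mul_of_nonneg_left (add_le_add (add_le_add t1 t2) (le_refl (βK * (4 / γ) ^ 2))) hC2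
  have e : β * (4 / γ) * (2 * CQ + 1) + CQ * (CQ + 1) *
      (β * (4 / γ * (2 * (8 / γ) + (8 / γ + 4 / γ) + 2 * ((8 / γ + 4 / γ * P) + 4 / γ) + a * CQ * (4 / γ) + a * (CQ + 1) * (4 / γ))) +
        15 * (β * sA) / Real.sqrt κ₁ * ((8 / γ + 4 / γ * P) * ((8 / γ + 4 / γ * P) + 4 / γ)) + βK * (4 / γ) ^ 2) =
      β * (4 / γ * (2 * CQ + 1) + CQ * (CQ + 1) *
          (4 / γ * (2 * (8 / γ) + (8 / γ + 4 / γ) + 2 * ((8 / γ + 4 / γ * P) + 4 / γ) + a * CQ * (4 / γ) + a * (CQ + 1) * (4 / γ)) +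
            15 * sA * ((8 / γ + 4 / γ * P) * ((8 / γ + 4 / γ * P) + 4 / γ)) / Real.sqrt κ₁)) +
        βK * (CQ * (CQ + 1) * (4 / γ) ^ 2) := by
    field_simp
    ring
  linarith

/-- **`small2` FROM ONE LINEAR β-CONSTRAINT**: `β·N₁ ≤ μ₁∕2 − β_K·C_Q(C_Q+1)(4∕γ)²` gives `B9Eq3126ConjugatedQG1QLetters.norm_c1k_le`'s window `s₁ ≤ μ₁∕2`
VERBATIM, for every `C_P ∈ [0, P]` and every `ρ ∈ [0, 15(βs_A)∕√κ₁]`. [folklore] (t4-ne9-idea-1 g142, L-g142-4)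
[cite: Balaban1985BackgroundPropagators, (3.126) p.420, (3.49) p.399, Thm 3.11 p.416; Balaban1985Variational, (45) p.285] -/
theorem small2_of_beta_linear {γ a βK CQ κ₁ sA β CP P ρ μ₁ : ℝ} (hγ : 0 < γ) (hCQ : 0 ≤ CQ) (hκ₁ : 0 < κ₁)
    (hβ : 0 ≤ β) (hCP : 0 ≤ CP) (hCPP : CP ≤ P) (hρ : 0 ≤ ρ) (hρle : ρ ≤ 15 * (β * sA) / Real.sqrt κ₁)
    (hβN : β * (4 / γ * (2 * CQ + 1) + CQ * (CQ + 1) *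
        (4 / γ * (2 * (8 / γ) + (8 / γ + 4 / γ) + 2 * ((8 / γ + 4 / γ * P) + 4 / γ) + a * CQ * (4 / γ) + a * (CQ + 1) * (4 / γ)) +
          15 * sA * ((8 / γ + 4 / γ * P) * ((8 / γ + 4 / γ * P) + 4 / γ)) / Real.sqrt κ₁)) ≤ μ₁ / 2 - βK * (CQ * (CQ + 1) * (4 / γ) ^ 2)) :
    β * (4 / γ) * (2 * CQ + 1) + CQ * (CQ + 1) *
        (β * (4 / γ * (2 * (8 / γ) + (8 / γ + 4 / γ) + 2 * ((8 / γ + 4 / γ * CP) + 4 / γ) + a * CQ * (4 / γ) + a * (CQ + 1) * (4 / γ))) +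
          ρ * ((8 / γ + 4 / γ * CP) * ((8 / γ + 4 / γ * CP) + 4 / γ)) + βK * (4 / γ) ^ 2) ≤ μ₁ / 2 := by
  have h := s1_le_affine (a := a) (βK := βK) hγ hCQ hκ₁ hβ hCP hCPP hρ hρle
  linarith

/-- `N₁ > 0` (its first summand is `(4∕γ)(2C_Q + 1) > 0`, the rest `≥ 0` for `P ≥ 0`). [folklore] [cite: Balaban1985BackgroundPropagators, (3.126) p.420] -/
theorem N1_pos {γ a CQ κ₁ sA P : ℝ} (hγ : 0 < γ) (ha : 0 ≤ a) (hCQ : 0 ≤ CQ) (hκ₁ : 0 < κ₁) (hsA : 0 ≤ sA) (hP : 0 ≤ P) :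
    0 < 4 / γ * (2 * CQ + 1) + CQ * (CQ + 1) *
        (4 / γ * (2 * (8 / γ) + (8 / γ + 4 / γ) + 2 * ((8 / γ + 4 / γ * P) + 4 / γ) + a * CQ * (4 / γ) + a * (CQ + 1) * (4 / γ)) +
          15 * sA * ((8 / γ + 4 / γ * P) * ((8 / γ + 4 / γ * P) + 4 / γ)) / Real.sqrt κ₁) := by
  have hsq : 0 < Real.sqrt κ₁ := Real.sqrt_pos.mpr hκ₁
  positivity

/-- **`β₁ > 0` EXACTLY WHEN THE `K`-LETTER LEAVES ROOM UNDER `μ₁∕2`**: `β_K·C_Q(C_Q+1)(4∕γ)² < μ₁∕2 ⟹ 0 < β₁ := (μ₁∕2 − β_K·C_Q(C_Q+1)(4∕γ)²)∕N₁`.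
[folklore] (t4-ne9-idea-1 g142, L-g142-4: «the K-letters must leave room under μ₁∕2 as well as under γ∕4»)
[cite: Balaban1985BackgroundPropagators, (3.126) p.420, Thm 3.11 p.416; Balaban1985Variational, (45) p.285] -/
theorem beta1_pos {γ a βK CQ κ₁ sA P μ₁ : ℝ} (hγ : 0 < γ) (ha : 0 ≤ a) (hCQ : 0 ≤ CQ) (hκ₁ : 0 < κ₁) (hsA : 0 ≤ sA) (hP : 0 ≤ P)
    (hgap : βK * (CQ * (CQ + 1) * (4 / γ) ^ 2) < μ₁ / 2) :
    0 < (μ₁ / 2 - βK * (CQ * (CQ + 1) * (4 / γ) ^ 2)) /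
      (4 / γ * (2 * CQ + 1) + CQ * (CQ + 1) *
        (4 / γ * (2 * (8 / γ) + (8 / γ + 4 / γ) + 2 * ((8 / γ + 4 / γ * P) + 4 / γ) + a * CQ * (4 / γ) + a * (CQ + 1) * (4 / γ)) +
          15 * sA * ((8 / γ + 4 / γ * P) * ((8 / γ + 4 / γ * P) + 4 / γ)) / Real.sqrt κ₁)) :=
  div_pos (by linarith) (N1_pos hγ ha hCQ hκ₁ hsA hP)

/-- **THE SECOND β-WINDOW AS ONE NUMBER**: `β ≤ β₁ ⟹ small2`, for every `C_P ∈ [0, P]` and `ρ ∈ [0, 15(βs_A)∕√κ₁]`.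
[folklore] (t4-ne9-idea-1 g142, L-g142-4) [cite: Balaban1985BackgroundPropagators, (3.126) p.420, (3.49) p.399; Balaban1985Variational, (45) p.285] -/
theorem small2_of_beta_le_beta1 {γ a βK CQ κ₁ sA β CP P ρ μ₁ : ℝ} (hγ : 0 < γ) (ha : 0 ≤ a) (hCQ : 0 ≤ CQ) (hκ₁ : 0 < κ₁) (hsA : 0 ≤ sA)
    (hP : 0 ≤ P) (hβ : 0 ≤ β) (hCP : 0 ≤ CP) (hCPP : CP ≤ P) (hρ : 0 ≤ ρ) (hρle : ρ ≤ 15 * (β * sA) / Real.sqrt κ₁)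
    (hβ1 : β ≤ (μ₁ / 2 - βK * (CQ * (CQ + 1) * (4 / γ) ^ 2)) /
      (4 / γ * (2 * CQ + 1) + CQ * (CQ + 1) *
        (4 / γ * (2 * (8 / γ) + (8 / γ + 4 / γ) + 2 * ((8 / γ + 4 / γ * P) + 4 / γ) + a * CQ * (4 / γ) + a * (CQ + 1) * (4 / γ)) +
          15 * sA * ((8 / γ + 4 / γ * P) * ((8 / γ + 4 / γ * P) + 4 / γ)) / Real.sqrt κ₁))) :
    β * (4 / γ) * (2 * CQ + 1) + CQ * (CQ + 1) *
        (β * (4 / γ * (2 * (8 / γ) + (8 / γ + 4 / γ) + 2 * ((8 / γ + 4 / γ * CP) + 4 / γ) + a * CQ * (4 / γ) + a * (CQ + 1) * (4 / γ))) +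
          ρ * ((8 / γ + 4 / γ * CP) * ((8 / γ + 4 / γ * CP) + 4 / γ)) + βK * (4 / γ) ^ 2) ≤ μ₁ / 2 := by
  have hN := N1_pos hγ ha hCQ hκ₁ hsA hP
  rw [le_div_iff₀ hN] at hβ1
  exact small2_of_beta_linear hγ hCQ hκ₁ hβ hCP hCPP hρ hρle (by linarith)

end Literature.MathematicalPhysics.QuantumFieldTheory.Balaban1983to89.B9Eq3126QG1QClosingBetaWindow
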